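import Literature.MathematicalPhysics.KineticTheory.LorentzGasRealizable
import Literature.Analysis.FunctionSpaces.PointConfigKernel
import HarnessLib

/-!
# Measurability of the virtual-orbit machinery and of the `n`-scatterer functional
(trunk T-KINETIC; topic MathematicalPhysics/KineticTheory; serves the core fact
`Literature.MathematicalPhysics.KineticTheory.gallavotti_lorentz_tendsto_dual` of `LorentzGasGallavotti`)

The multivariate Mecke equation (`Literature.multivariateMecke`) is applied to the `n`-scatterer
functional `(x, c) ↦ scattererFunctional ω₀ ε z t φ (List.ofFn x) c` of `LorentzGasRealizable`;
this file supplies its joint measurability on `(Fin n → E) × PointConfig E`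
(`Kinetic.measurable_scattererFunctional`). Lists carry no measurable structure, so every
list-recursive object is accessed through `List.ofFn` and measurability is proved by induction on
the length, passing the state along:

* `Kinetic.measurable_virtualState`: `(z, q, τ) ↦ virtualState z (List.ofFn q) τ`;
* `Kinetic.exists_measurable_virtualCentres`, `Kinetic.exists_measurable_chainParams`: measurable
  parametrisations `G`, `F` with `List.ofFn (G (z, q)) = virtualCentres ε z (List.ofFn q)` and
  `List.ofFn (F (z, x)) = chainParams ω₀ ε z (List.ofFn x)` (entrance time and normal are
  measurable: a square root and a division);
* `Kinetic.measurableSet_isHitChain`;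
* `Kinetic.continuous_virtualState_fst`: for positive durations the virtual *position* is
  continuous in time, so that the tube condition "`∃ τ ∈ [0, t]`, `dist a x(τ) < ε`" reduces to
  rational times (`Kinetic.mem_virtualTube_iff_rat`) and the tube graph is measurable
  (`Kinetic.measurableSet_virtualTube_graph`);
* the void event `{(x, c) : no point of c in the tube}` is then measurable by the counting-kernel
  lemma `PointConfig.measurableSet_count_preimage_eq_zero`.

## References

* G. Last, M. Penrose, *Lectures on the Poisson Process*, CUP (2017), Thm. 4.4 (the measurability
  required of the integrand).
-/

open MeasureTheory Metric Real Set Filter Topology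
open scoped InnerProductSpace ENNReal

namespace Literature.MathematicalPhysics.KineticTheory

noncomputable section

variable {E : Type*} [NormedAddCommGroup E] [InnerProductSpace ℝ E] [FiniteDimensional ℝ E]
  [MeasurableSpace E] [BorelSpace E]

/-! ### Entrance data -/

omit [FiniteDimensional ℝ E] in
/-- The entrance time is jointly measurable in `(x, v, c)`. [folklore] -/
theorem measurable_entryTime [SecondCountableTopology E] (ε : ℝ) :
    Measurable fun p : (E × E) × E => Literature.Analysis.FunctionSpaces.entryTime p.1.1 p.1.2 ε p.2 := by
  unfold Literature.Analysis.FunctionSpaces.entryTime Literature.Analysis.FluidPDE.pairHitTime Literature.Analysis.FluidPDE.pairDisc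
  have hq : Measurable fun p : (E × E) × E => p.1.1 - p.2 := measurable_fst.fst.sub measurable_snd
  have hw : Measurable fun p : (E × E) × E => p.1.2 := measurable_fst.snd
  have hin : Measurable fun p : (E × E) × E => ⟪p.1.1 - p.2, p.1.2⟫_ℝ := hq.inner hw
  refine ((hin.neg).sub (Measurable.sqrt ?_)).div ((hw.norm).pow_const 2)
  exact ((hin.pow_const 2).sub (((hw.norm).pow_const 2).mul (((hq.norm).pow_const 2).sub
    measurable_const)))

omit [FiniteDimensional ℝ E] in
/-- The entrance normal is jointly measurable in `(x, v, c)`. [folklore] -/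
theorem measurable_entryNormal [SecondCountableTopology E] (ε : ℝ) :
    Measurable fun p : (E × E) × E => Literature.Analysis.FunctionSpaces.entryNormal p.1.1 p.1.2 ε p.2 := by
  unfold Literature.Analysis.FunctionSpaces.entryNormal
  exact (measurable_snd.sub (measurable_fst.fst.add ((measurable_entryTime ε).smul
    measurable_fst.snd))).const_smul _

omit [FiniteDimensional ℝ E] in
/-- The hit state is jointly measurable in `(z, c)`. [folklore] -/
theorem measurable_hitState [SecondCountableTopology E] (ε : ℝ) :
    Measurable fun p : (E × E) × E => hitState ε p.1 p.2 := by
  unfold hitState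
  have ht := measurable_entryTime (E := E) ε
  have hn := measurable_entryNormal (E := E) ε
  exact (measurable_fst.fst.add (ht.smul measurable_fst.snd)).prodMk
    (measurable_fst.snd.sub ((measurable_const.mul (measurable_fst.snd.inner hn)).smul hn))

omit [FiniteDimensional ℝ E] in
/-- The sphere-valued entrance normal used by `chainParams` (with junk value `ω₀` off the unit
sphere) is jointly measurable. [folklore] -/
theorem measurable_entryNormalSphere [SecondCountableTopology E] (ω₀ : sphere (0 : E) 1) (ε : ℝ) :
    Measurable fun p : (E × E) × E => (if h : ‖Literature.Analysis.FunctionSpaces.entryNormal p.1.1 p.1.2 ε p.2‖ = 1 then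
      (⟨Literature.Analysis.FunctionSpaces.entryNormal p.1.1 p.1.2 ε p.2, mem_sphere_zero_iff_norm.2 h⟩ : sphere (0 : E) 1) else ω₀) := by
  have hn := measurable_entryNormal (E := E) ε
  set S : Set ((E × E) × E) := {p | ‖Literature.Analysis.FunctionSpaces.entryNormal p.1.1 p.1.2 ε p.2‖ = 1} with hS_def
  have hS : MeasurableSet S := measurableSet_eq_fun hn.norm measurable_const
  have heq : (fun p : (E × E) × E => (if h : ‖Literature.Analysis.FunctionSpaces.entryNormal p.1.1 p.1.2 ε p.2‖ = 1 then
      (⟨Literature.Analysis.FunctionSpaces.entryNormal p.1.1 p.1.2 ε p.2, mem_sphere_zero_iff_norm.2 h⟩ : sphere (0 : E) 1) else ω₀)) =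
      fun p => if hx : p ∈ S then (⟨Literature.Analysis.FunctionSpaces.entryNormal p.1.1 p.1.2 ε p.2,
        mem_sphere_zero_iff_norm.2 (by simpa [hS_def] using hx)⟩ : sphere (0 : E) 1) else ω₀ := by
    funext p
    by_cases h : ‖Literature.Analysis.FunctionSpaces.entryNormal p.1.1 p.1.2 ε p.2‖ = 1
    · rw [dif_pos h, dif_pos (by simpa [hS_def] using h)]
    · rw [dif_neg h, dif_neg (by simpa [hS_def] using h)]
  rw [heq]
  exact Measurable.dite (f := fun x : S => (⟨Literature.Analysis.FunctionSpaces.entryNormal x.1.1.1 x.1.1.2 ε x.1.2,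
    mem_sphere_zero_iff_norm.2 (show (x : (E × E) × E) ∈ S from x.2)⟩ : sphere (0 : E) 1))
    ((hn.comp measurable_subtype_coe).subtype_mk) measurable_const hS

/-! ### The virtual orbit -/

omit [FiniteDimensional ℝ E] in
/-- **The virtual state is jointly measurable** in the initial state, the `n` path coordinates and
the time. [folklore] -/
theorem measurable_virtualState [SecondCountableTopology E] (n : ℕ) :
    Measurable fun p : (E × E) × (Fin n → ℝ × sphere (0 : E) 1) × ℝ =>
      Literature.Analysis.FunctionSpaces.virtualState p.1 (List.ofFn p.2.1) p.2.2 := by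
  induction n with
  | zero =>
    simp only [List.ofFn_zero, Literature.Analysis.FunctionSpaces.virtualState_nil]
    exact (measurable_fst.fst.add (measurable_snd.snd.smul measurable_fst.snd)).prodMk
      measurable_fst.snd
  | succ n ih =>
    have hcons : ∀ p : (E × E) × (Fin (n + 1) → ℝ × sphere (0 : E) 1) × ℝ,
        Literature.Analysis.FunctionSpaces.virtualState p.1 (List.ofFn p.2.1) p.2.2 =
          if p.2.2 < (p.2.1 0).1 then (p.1.1 + p.2.2 • p.1.2, p.1.2) else
            Literature.Analysis.FunctionSpaces.virtualState (p.1.1 + (p.2.1 0).1 • p.1.2,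
              p.1.2 - (2 * ⟪p.1.2, ((p.2.1 0).2 : E)⟫_ℝ) • ((p.2.1 0).2 : E))
              (List.ofFn fun i : Fin n => p.2.1 i.succ) (p.2.2 - (p.2.1 0).1) := by
      intro p
      rw [List.ofFn_succ]
      rcases h0 : p.2.1 0 with ⟨u, ω⟩
      rw [Literature.Analysis.FunctionSpaces.virtualState_cons]
    simp_rw [hcons]
    have hq0 : Measurable fun p : (E × E) × (Fin (n + 1) → ℝ × sphere (0 : E) 1) × ℝ => p.2.1 0 :=
      (measurable_pi_apply 0).comp measurable_snd.fst
    have hu : Measurable fun p : (E × E) × (Fin (n + 1) → ℝ × sphere (0 : E) 1) × ℝ => (p.2.1 0).1 :=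
      hq0.fst
    have hω : Measurable fun p : (E × E) × (Fin (n + 1) → ℝ × sphere (0 : E) 1) × ℝ =>
        (((p.2.1 0).2 : sphere (0 : E) 1) : E) := measurable_subtype_coe.comp hq0.snd
    have hτ : Measurable fun p : (E × E) × (Fin (n + 1) → ℝ × sphere (0 : E) 1) × ℝ => p.2.2 :=
      measurable_snd.snd
    have hx : Measurable fun p : (E × E) × (Fin (n + 1) → ℝ × sphere (0 : E) 1) × ℝ => p.1.1 :=
      measurable_fst.fst
    have hv : Measurable fun p : (E × E) × (Fin (n + 1) → ℝ × sphere (0 : E) 1) × ℝ => p.1.2 :=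
      measurable_fst.snd
    refine Measurable.ite (measurableSet_lt hτ hu) ((hx.add (hτ.smul hv)).prodMk hv) ?_
    have hmap : Measurable fun p : (E × E) × (Fin (n + 1) → ℝ × sphere (0 : E) 1) × ℝ =>
        ((p.1.1 + (p.2.1 0).1 • p.1.2,
          p.1.2 - (2 * ⟪p.1.2, ((p.2.1 0).2 : E)⟫_ℝ) • ((p.2.1 0).2 : E)),
          (fun i : Fin n => p.2.1 i.succ), p.2.2 - (p.2.1 0).1) :=
      ((hx.add (hu.smul hv)).prodMk (hv.sub ((measurable_const.mul (hv.inner hω)).smul hω))).prodMk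
        ((measurable_pi_iff.2 fun i => (measurable_pi_apply _).comp measurable_snd.fst).prodMk
          (hτ.sub hu))
    exact ih.comp hmap

omit [FiniteDimensional ℝ E] in
/-- **A measurable parametrisation of the realising centres**: there is a measurable
`G : (z, q) ↦ (Fin n → E)` with `List.ofFn (G (z, q)) = virtualCentres ε z (List.ofFn q)`.
[folklore] -/
theorem exists_measurable_virtualCentres [SecondCountableTopology E] (ε : ℝ) (n : ℕ) :
    ∃ G : (E × E) × (Fin n → ℝ × sphere (0 : E) 1) → (Fin n → E), Measurable G ∧
      ∀ p, List.ofFn (G p) = Literature.Analysis.FunctionSpaces.virtualCentres ε p.1 (List.ofFn p.2) := by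
  induction n with
  | zero => exact ⟨fun _ => Fin.elim0, measurable_const, fun p => by simp⟩
  | succ n ih =>
    obtain ⟨G, hG, hGeq⟩ := ih
    refine ⟨fun p => Fin.cons (p.1.1 + (p.2 0).1 • p.1.2 + ε • (((p.2 0).2 : sphere (0 : E) 1) : E))
      (G ((p.1.1 + (p.2 0).1 • p.1.2,
        p.1.2 - (2 * ⟪p.1.2, (((p.2 0).2 : sphere (0 : E) 1) : E)⟫_ℝ) • (((p.2 0).2 : sphere (0 : E) 1) : E)),
        fun i : Fin n => p.2 i.succ)), ?_, fun p => ?_⟩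
    · have hq0 : Measurable fun p : (E × E) × (Fin (n + 1) → ℝ × sphere (0 : E) 1) => p.2 0 :=
        (measurable_pi_apply 0).comp measurable_snd
      have hu : Measurable fun p : (E × E) × (Fin (n + 1) → ℝ × sphere (0 : E) 1) => (p.2 0).1 :=
        hq0.fst
      have hω : Measurable fun p : (E × E) × (Fin (n + 1) → ℝ × sphere (0 : E) 1) =>
          (((p.2 0).2 : sphere (0 : E) 1) : E) := measurable_subtype_coe.comp hq0.snd
      have hx : Measurable fun p : (E × E) × (Fin (n + 1) → ℝ × sphere (0 : E) 1) => p.1.1 :=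
        measurable_fst.fst
      have hv : Measurable fun p : (E × E) × (Fin (n + 1) → ℝ × sphere (0 : E) 1) => p.1.2 :=
        measurable_fst.snd
      have hmap : Measurable fun p : (E × E) × (Fin (n + 1) → ℝ × sphere (0 : E) 1) =>
          ((p.1.1 + (p.2 0).1 • p.1.2,
            p.1.2 - (2 * ⟪p.1.2, (((p.2 0).2 : sphere (0 : E) 1) : E)⟫_ℝ) •
              (((p.2 0).2 : sphere (0 : E) 1) : E)), fun i : Fin n => p.2 i.succ) :=
        ((hx.add (hu.smul hv)).prodMk (hv.sub ((measurable_const.mul (hv.inner hω)).smul hω))).prodMk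
          (measurable_pi_iff.2 fun i => (measurable_pi_apply _).comp measurable_snd)
      exact measurable_pi_iff.2 fun i => by
        refine Fin.cases ?_ (fun j => ?_) i
        · simp only [Fin.cons_zero]
          exact (hx.add (hu.smul hv)).add (hω.const_smul ε)
        · simp only [Fin.cons_succ]
          exact (measurable_pi_apply j).comp (hG.comp hmap)
    · dsimp only
      rw [List.ofFn_succ, Fin.cons_zero]
      simp only [Fin.cons_succ]
      rw [hGeq, List.ofFn_succ]
      rcases p.2 0 with ⟨u, ω⟩
      rw [Literature.Analysis.FunctionSpaces.virtualCentres_cons]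

omit [FiniteDimensional ℝ E] in
/-- **A measurable parametrisation of the path coordinates of a hit chain**: there is a measurable
`F : (z, x) ↦ (Fin n → ℝ × S)` with `List.ofFn (F (z, x)) = chainParams ω₀ ε z (List.ofFn x)`.
[folklore] -/
theorem exists_measurable_chainParams [SecondCountableTopology E] (ω₀ : sphere (0 : E) 1) (ε : ℝ)
    (n : ℕ) :
    ∃ F : (E × E) × (Fin n → E) → (Fin n → ℝ × sphere (0 : E) 1), Measurable F ∧
      ∀ p, List.ofFn (F p) = chainParams ω₀ ε p.1 (List.ofFn p.2) := by
  induction n with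
  | zero => exact ⟨fun _ => Fin.elim0, measurable_const, fun p => by simp⟩
  | succ n ih =>
    obtain ⟨F, hF, hFeq⟩ := ih
    refine ⟨fun p => Fin.cons (Literature.Analysis.FunctionSpaces.entryTime p.1.1 p.1.2 ε (p.2 0),
        if h : ‖Literature.Analysis.FunctionSpaces.entryNormal p.1.1 p.1.2 ε (p.2 0)‖ = 1 then
          (⟨Literature.Analysis.FunctionSpaces.entryNormal p.1.1 p.1.2 ε (p.2 0), mem_sphere_zero_iff_norm.2 h⟩ : sphere (0 : E) 1)
        else ω₀) (F (hitState ε p.1 (p.2 0), fun i : Fin n => p.2 i.succ)), ?_, fun p => ?_⟩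
    · have hza : Measurable fun p : (E × E) × (Fin (n + 1) → E) => (p.1, p.2 0) :=
        measurable_fst.prodMk ((measurable_pi_apply 0).comp measurable_snd)
      have ht := (measurable_entryTime (E := E) ε).comp hza
      have hns := (measurable_entryNormalSphere (E := E) ω₀ ε).comp hza
      have hhs := (measurable_hitState (E := E) ε).comp hza
      have hmap : Measurable fun p : (E × E) × (Fin (n + 1) → E) =>
          (hitState ε p.1 (p.2 0), fun i : Fin n => p.2 i.succ) :=
        hhs.prodMk (measurable_pi_iff.2 fun i => (measurable_pi_apply _).comp measurable_snd)
      exact measurable_pi_iff.2 fun i => by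
        refine Fin.cases ?_ (fun j => ?_) i
        · simp only [Fin.cons_zero]
          exact ht.prodMk hns
        · simp only [Fin.cons_succ]
          exact (measurable_pi_apply j).comp (hF.comp hmap)
    · dsimp only
      rw [List.ofFn_succ, Fin.cons_zero]
      simp only [Fin.cons_succ]
      rw [hFeq, List.ofFn_succ, chainParams_cons]

omit [FiniteDimensional ℝ E] in
/-- **The hit-chain condition is measurable** in `(z, x)`. [folklore] -/
theorem measurableSet_isHitChain [SecondCountableTopology E] (ε : ℝ) (n : ℕ) :
    MeasurableSet {p : (E × E) × (Fin n → E) | IsHitChain ε p.1 (List.ofFn p.2)} := by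
  induction n with
  | zero =>
    have : {p : (E × E) × (Fin 0 → E) | IsHitChain ε p.1 (List.ofFn p.2)} = univ := by
      ext p; simp [List.ofFn_zero]
    rw [this]; exact MeasurableSet.univ
  | succ n ih =>
    have hcons : ∀ p : (E × E) × (Fin (n + 1) → E), IsHitChain ε p.1 (List.ofFn p.2) ↔
        (∃ τ : ℝ, dist (p.2 0) (p.1.1 + τ • p.1.2) < ε) ∧
          IsHitChain ε (hitState ε p.1 (p.2 0)) (List.ofFn fun i : Fin n => p.2 i.succ) := by
      intro p; rw [List.ofFn_succ, isHitChain_cons]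
    simp_rw [hcons, Set.setOf_and]
    refine MeasurableSet.inter ?_ ?_
    · -- an open condition
      have hopen : IsOpen {p : (E × E) × (Fin (n + 1) → E) | ∃ τ : ℝ, dist (p.2 0) (p.1.1 + τ • p.1.2) < ε} := by
        rw [show {p : (E × E) × (Fin (n + 1) → E) | ∃ τ : ℝ, dist (p.2 0) (p.1.1 + τ • p.1.2) < ε} =
          ⋃ τ : ℝ, {p | dist (p.2 0) (p.1.1 + τ • p.1.2) < ε} by ext p; simp]
        refine isOpen_iUnion fun τ => isOpen_lt ?_ continuous_const
        exact ((continuous_apply 0).comp continuous_snd).dist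
          (continuous_fst.fst.add (continuous_const.smul continuous_fst.snd))
      exact hopen.measurableSet
    · have hmap : Measurable fun p : (E × E) × (Fin (n + 1) → E) =>
          (hitState ε p.1 (p.2 0), fun i : Fin n => p.2 i.succ) :=
        ((measurable_hitState (E := E) ε).comp (measurable_fst.prodMk
          ((measurable_pi_apply 0).comp measurable_snd))).prodMk
          (measurable_pi_iff.2 fun i => (measurable_pi_apply _).comp measurable_snd)
      exact ih.preimage hmap

/-! ### Continuity of the virtual position in time; the tube through rational times -/

omit [FiniteDimensional ℝ E] [MeasurableSpace E] [BorelSpace E] in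
/-- **The virtual position is continuous in time** when all durations are positive (the velocity
jumps at the collision instants, the position does not). [folklore] -/
theorem continuous_virtualState_fst :
    ∀ (p : List (ℝ × sphere (0 : E) 1)) (z : E × E), (∀ q ∈ p, 0 < q.1) →
      Continuous fun τ : ℝ => (Literature.Analysis.FunctionSpaces.virtualState z p τ).1
  | [], z, _ => by
    simp only [Literature.Analysis.FunctionSpaces.virtualState_nil]
    exact continuous_const.add (continuous_id.smul continuous_const)
  | (u, ω) :: p, z, hdur => by
    have hdur' : ∀ q ∈ p, 0 < q.1 := fun q hq => hdur q (List.mem_cons_of_mem _ hq)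
    set z₁ : E × E := (z.1 + u • z.2, z.2 - (2 * ⟪z.2, (ω : E)⟫_ℝ) • (ω : E)) with hz₁
    have ih := continuous_virtualState_fst p z₁ hdur'
    have heq : (fun τ : ℝ => (Literature.Analysis.FunctionSpaces.virtualState z ((u, ω) :: p) τ).1) =
        fun τ => if u ≤ τ then (Literature.Analysis.FunctionSpaces.virtualState z₁ p (τ - u)).1 else z.1 + τ • z.2 := by
      funext τ
      by_cases h : u ≤ τ
      · rw [if_pos h, Literature.Analysis.FunctionSpaces.virtualState_cons_of_le z ω p h]
      · rw [if_neg h, Literature.Analysis.FunctionSpaces.virtualState_cons_of_lt z ω p (not_le.1 h)]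
    rw [heq]
    refine Continuous.if_le (ih.comp (continuous_id.sub continuous_const))
      (continuous_const.add (continuous_id.smul continuous_const)) continuous_const continuous_id ?_
    rintro τ rfl
    simp only [sub_self]
    rw [Literature.Analysis.FunctionSpaces.virtualState_zero]
    intro q hq
    cases p with
    | nil => simp at hq
    | cons q' p' =>
      simp only [List.head?_cons, Option.mem_def, Option.some.injEq] at hq
      subst hq
      exact hdur' q' List.mem_cons_self

omit [FiniteDimensional ℝ E] [MeasurableSpace E] [BorelSpace E] in
/-- **The tube through rational times**: for positive durations and `t ≥ 0`, a point is in the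
virtual tube iff it is within `< ε` of the virtual position at some *rational* time in `[0, t]`,
or within `≤ ε` of the final position (continuity of the position, density of `ℚ`). [folklore] -/
theorem mem_virtualTube_iff_rat {ε : ℝ} {z : E × E} {t : ℝ} (ht : 0 ≤ t)
    {p : List (ℝ × sphere (0 : E) 1)} (hdur : ∀ q ∈ p, 0 < q.1) {a : E} :
    a ∈ virtualTube ε z t p ↔ (∃ r : ℚ, (r : ℝ) ∈ Icc (0 : ℝ) t ∧ dist a (Literature.Analysis.FunctionSpaces.virtualState z p r).1 < ε) ∨
      dist a (Literature.Analysis.FunctionSpaces.virtualState z p t).1 ≤ ε := by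
  rw [mem_virtualTube]
  refine or_congr_left ⟨?_, fun ⟨r, hr, hlt⟩ => ⟨r, hr, hlt⟩⟩
  rintro ⟨τ, hτ, hlt⟩
  -- the set of good times is open and contains `τ`
  have hcont : Continuous fun σ : ℝ => dist a (Literature.Analysis.FunctionSpaces.virtualState z p σ).1 :=
    continuous_const.dist (continuous_virtualState_fst p z hdur)
  have hopen : IsOpen {σ : ℝ | dist a (Literature.Analysis.FunctionSpaces.virtualState z p σ).1 < ε} := isOpen_lt hcont continuous_const
  obtain ⟨δ, hδ, hball⟩ := Metric.isOpen_iff.1 hopen τ hlt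
  rcases ht.eq_or_lt with rfl | htpos
  · -- `t = 0`: then `τ = 0` is rational
    have hτ0 : τ = 0 := le_antisymm hτ.2 hτ.1
    exact ⟨0, by simp, by simpa [hτ0] using hlt⟩
  · -- a rational in `[0, t] ∩ (τ - δ, τ + δ)`
    obtain ⟨r, hr1, hr2⟩ := exists_rat_btwn (show max 0 (τ - δ / 2) < min t (τ + δ / 2) by
      rw [max_lt_iff, lt_min_iff, lt_min_iff]; exact ⟨⟨htpos, by linarith [hτ.1]⟩, by linarith [hτ.2], by linarith⟩)
    rw [max_lt_iff] at hr1
    rw [lt_min_iff] at hr2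
    refine ⟨r, ⟨hr1.1.le, hr2.1.le⟩, hball ?_⟩
    rw [Metric.mem_ball, Real.dist_eq, abs_lt]
    constructor <;> linarith [hr1.2, hr2.2]

omit [FiniteDimensional ℝ E] in
/-- **The tube graph is measurable**: the set of `((z, q), a)` with all durations of `q` positive
and `a` in the tube `virtualTube ε z t (List.ofFn q)` is measurable (`t ≥ 0`). [folklore] -/
theorem measurableSet_virtualTube_graph [SecondCountableTopology E] (ε : ℝ) {t : ℝ} (ht : 0 ≤ t)
    (n : ℕ) :
    MeasurableSet {p : ((E × E) × (Fin n → ℝ × sphere (0 : E) 1)) × E |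
      (∀ i, 0 < (p.1.2 i).1) ∧ p.2 ∈ virtualTube ε p.1.1 t (List.ofFn p.1.2)} := by
  have hpos : MeasurableSet {p : ((E × E) × (Fin n → ℝ × sphere (0 : E) 1)) × E | ∀ i, 0 < (p.1.2 i).1} := by
    rw [show {p : ((E × E) × (Fin n → ℝ × sphere (0 : E) 1)) × E | ∀ i, 0 < (p.1.2 i).1} =
      ⋂ i, {p | 0 < (p.1.2 i).1} by ext p; simp]
    exact MeasurableSet.iInter fun i =>
      measurableSet_lt measurable_const ((measurable_pi_apply i).comp measurable_fst.snd).fst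
  -- measurability of `((z, q), a) ↦ dist a (virtualState z (ofFn q) σ).1` for each time `σ`
  have hdist : ∀ σ : ℝ, Measurable fun p : ((E × E) × (Fin n → ℝ × sphere (0 : E) 1)) × E =>
      dist p.2 (Literature.Analysis.FunctionSpaces.virtualState p.1.1 (List.ofFn p.1.2) σ).1 := fun σ => by
    have h := (measurable_virtualState (E := E) n).comp (measurable_fst.fst.prodMk
      (measurable_fst.snd.prodMk (measurable_const (a := σ))) :
        Measurable fun p : ((E × E) × (Fin n → ℝ × sphere (0 : E) 1)) × E => (p.1.1, p.1.2, σ))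
    exact measurable_snd.dist h.fst
  have heq : {p : ((E × E) × (Fin n → ℝ × sphere (0 : E) 1)) × E |
      (∀ i, 0 < (p.1.2 i).1) ∧ p.2 ∈ virtualTube ε p.1.1 t (List.ofFn p.1.2)} =
      {p | ∀ i, 0 < (p.1.2 i).1} ∩
        ((⋃ r : ℚ, {p | (r : ℝ) ∈ Icc (0 : ℝ) t ∧ dist p.2 (Literature.Analysis.FunctionSpaces.virtualState p.1.1 (List.ofFn p.1.2) r).1 < ε}) ∪
          {p | dist p.2 (Literature.Analysis.FunctionSpaces.virtualState p.1.1 (List.ofFn p.1.2) t).1 ≤ ε}) := by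
    ext p
    simp only [mem_setOf_eq, mem_inter_iff, mem_union, mem_iUnion]
    constructor
    · rintro ⟨hp, hmem⟩
      refine ⟨hp, ?_⟩
      rwa [mem_virtualTube_iff_rat ht ((List.forall_mem_ofFn_iff).2 hp)] at hmem
    · rintro ⟨hp, hmem⟩
      refine ⟨hp, ?_⟩
      rwa [mem_virtualTube_iff_rat ht ((List.forall_mem_ofFn_iff).2 hp)]
  rw [heq]
  refine hpos.inter (MeasurableSet.union (MeasurableSet.iUnion fun r => ?_) ?_)
  · by_cases hr : (r : ℝ) ∈ Icc (0 : ℝ) t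
    · simp only [hr, true_and]
      exact measurableSet_lt (hdist r) measurable_const
    · simp only [hr, false_and, setOf_false, MeasurableSet.empty]
  · exact measurableSet_le (hdist t) measurable_const

/-! ### The `n`-scatterer functional -/

omit [InnerProductSpace ℝ E] [FiniteDimensional ℝ E] [MeasurableSpace E] [BorelSpace E] in
/-- Voidness of a set for a configuration in terms of the counting function. [folklore] -/
theorem forall_notMem_iff_count_eq_zero (c : Literature.Analysis.FunctionSpaces.PointConfig E) (s : Set E) :
    (∀ a ∈ c, a ∉ s) ↔ c.count s = 0 := by
  rw [Literature.Analysis.FunctionSpaces.PointConfig.count, Set.encard_eq_zero, Set.eq_empty_iff_forall_notMem]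
  simp only [mem_inter_iff, not_and]
  rfl

/-- **Measurability of the `n`-scatterer functional** on `(Fin n → E) × PointConfig E`, for a
measurable observable and `t ≥ 0`: the realizability conditions are measurable in the chain
(through the measurable parametrisations of `chainParams` and `virtualCentres`, the hit-chain
set, and the tube graph), and the void event is measurable by the counting-kernel lemma. This is
the measurability required by the multivariate Mecke equation. [folklore] -/
theorem measurable_scattererFunctional [SecondCountableTopology E] [SigmaCompactSpace E]
    (ω₀ : sphere (0 : E) 1) (ε : ℝ) (z : E × E) {t : ℝ} (ht : 0 ≤ t) {φ : E × E → ℝ}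
    (hφ : Measurable φ) (n : ℕ) :
    Measurable fun p : (Fin n → E) × Literature.Analysis.FunctionSpaces.PointConfig E => scattererFunctional ω₀ ε z t φ (List.ofFn p.1) p.2 := by
  classical
  obtain ⟨F, hF, hFeq⟩ := exists_measurable_chainParams (E := E) ω₀ ε n
  obtain ⟨G, hG, hGeq⟩ := exists_measurable_virtualCentres (E := E) ε n
  -- the chain coordinates as a measurable function of `p`
  have hFz : Measurable fun p : (Fin n → E) × Literature.Analysis.FunctionSpaces.PointConfig E => F (z, p.1) :=
    hF.comp (measurable_const.prodMk measurable_fst)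
  have hcp : ∀ p : (Fin n → E) × Literature.Analysis.FunctionSpaces.PointConfig E, chainParams ω₀ ε z (List.ofFn p.1) = List.ofFn (F (z, p.1)) :=
    fun p => (hFeq (z, p.1)).symm
  -- the realizability set
  set R : Set ((Fin n → E) × Literature.Analysis.FunctionSpaces.PointConfig E) := {p | IsRealizable ω₀ ε z t (List.ofFn p.1) p.2} with hR
  have hReq : R = {p | IsHitChain ε z (List.ofFn p.1)} ∩ {p | ∀ i, 0 < (F (z, p.1) i).1} ∩
      {p | ∑ i, (F (z, p.1) i).1 < t} ∩ {p | ∀ i, G (z, F (z, p.1)) i = p.1 i} ∩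
      ({p | ∀ i, 0 < (F (z, p.1) i).1} ∩
        {p | p.2.count (Prod.mk p ⁻¹'
          {q : ((Fin n → E) × Literature.Analysis.FunctionSpaces.PointConfig E) × E | ((z, F (z, q.1.1)), q.2) ∈
            {q : ((E × E) × (Fin n → ℝ × sphere (0 : E) 1)) × E |
              (∀ i, 0 < (q.1.2 i).1) ∧ q.2 ∈ virtualTube ε q.1.1 t (List.ofFn q.1.2)}}) = 0}) := by
    ext p
    simp only [hR, mem_setOf_eq, IsRealizable, mem_inter_iff, hcp p, List.forall_mem_ofFn_iff,
      List.map_ofFn, List.sum_ofFn]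
    have hcen : Literature.Analysis.FunctionSpaces.virtualCentres ε z (List.ofFn (F (z, p.1))) = List.ofFn p.1 ↔
        ∀ i, G (z, F (z, p.1)) i = p.1 i := by
      rw [← hGeq (z, F (z, p.1)), List.ofFn_inj]
      exact funext_iff
    rw [hcen]
    constructor
    · rintro ⟨h1, h2, h3, h4, h5⟩
      refine ⟨⟨⟨⟨h1, h2⟩, h3⟩, h4⟩, h2, ?_⟩
      rw [← forall_notMem_iff_count_eq_zero]
      intro a ha hmem
      simp only [mem_preimage, mem_setOf_eq] at hmem
      exact h5 a ha hmem.2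
    · rintro ⟨⟨⟨⟨h1, h2⟩, h3⟩, h4⟩, -, h5⟩
      refine ⟨h1, h2, h3, h4, ?_⟩
      rw [← forall_notMem_iff_count_eq_zero] at h5
      intro a ha hmem
      exact h5 a ha (by simp only [mem_preimage, mem_setOf_eq]; exact ⟨h2, hmem⟩)
  have hRm : MeasurableSet R := by
    rw [hReq]
    refine (((MeasurableSet.inter ?_ ?_).inter ?_).inter ?_).inter (MeasurableSet.inter ?_ ?_)
    · exact (measurableSet_isHitChain (E := E) ε n).preimage (measurable_const.prodMk measurable_fst)
    · rw [show {p : (Fin n → E) × Literature.Analysis.FunctionSpaces.PointConfig E | ∀ i, 0 < (F (z, p.1) i).1} = ⋂ i, {p | 0 < (F (z, p.1) i).1}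
        by ext p; simp]
      exact MeasurableSet.iInter fun i => measurableSet_lt measurable_const ((measurable_pi_apply i).comp hFz).fst
    · exact measurableSet_lt (Finset.measurable_sum _ fun i _ => ((measurable_pi_apply i).comp hFz).fst)
        measurable_const
    · rw [show {p : (Fin n → E) × Literature.Analysis.FunctionSpaces.PointConfig E | ∀ i, G (z, F (z, p.1)) i = p.1 i} =
        ⋂ i, {p | G (z, F (z, p.1)) i = p.1 i} by ext p; simp]
      exact MeasurableSet.iInter fun i => measurableSet_eq_fun
        ((measurable_pi_apply i).comp (hG.comp (measurable_const.prodMk hFz)))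
        ((measurable_pi_apply i).comp measurable_fst)
    · rw [show {p : (Fin n → E) × Literature.Analysis.FunctionSpaces.PointConfig E | ∀ i, 0 < (F (z, p.1) i).1} = ⋂ i, {p | 0 < (F (z, p.1) i).1}
        by ext p; simp]
      exact MeasurableSet.iInter fun i => measurableSet_lt measurable_const ((measurable_pi_apply i).comp hFz).fst
    · -- the void event, by the counting kernel
      have hgraph := measurableSet_virtualTube_graph (E := E) ε ht n
      have hmap : Measurable fun p : (Fin n → E) × Literature.Analysis.FunctionSpaces.PointConfig E => ((z, F (z, p.1)) :
          (E × E) × (Fin n → ℝ × sphere (0 : E) 1)) := measurable_const.prodMk hFz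
      have hpre : MeasurableSet {q : ((Fin n → E) × Literature.Analysis.FunctionSpaces.PointConfig E) × E |
          ((z, F (z, q.1.1)), q.2) ∈ {q : ((E × E) × (Fin n → ℝ × sphere (0 : E) 1)) × E |
            (∀ i, 0 < (q.1.2 i).1) ∧ q.2 ∈ virtualTube ε q.1.1 t (List.ofFn q.1.2)}} :=
        hgraph.preimage ((hmap.comp measurable_fst).prodMk measurable_snd)
      have h := Literature.Analysis.FunctionSpaces.PointConfig.measurableSet_count_preimage_eq_zero hpre measurable_snd
      convert h using 3
  -- the value on the realizability set
  have hval : Measurable fun p : (Fin n → E) × Literature.Analysis.FunctionSpaces.PointConfig E =>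
      ENNReal.ofReal (φ (Literature.Analysis.FunctionSpaces.virtualState z (List.ofFn (F (z, p.1))) t)) := by
    have h := (measurable_virtualState (E := E) n).comp
      ((measurable_const (a := z)).prodMk (hFz.prodMk (measurable_const (a := t))))
    exact ENNReal.measurable_ofReal.comp (hφ.comp h)
  have hfun : (fun p : (Fin n → E) × Literature.Analysis.FunctionSpaces.PointConfig E => scattererFunctional ω₀ ε z t φ (List.ofFn p.1) p.2) =
      R.indicator fun p => ENNReal.ofReal (φ (Literature.Analysis.FunctionSpaces.virtualState z (List.ofFn (F (z, p.1))) t)) := by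
    funext p
    by_cases hp : p ∈ R
    · rw [indicator_of_mem hp, scattererFunctional_of hp, hcp p]
    · rw [indicator_of_notMem hp, scattererFunctional_of_not hp]
  rw [hfun]
  exact hval.indicator hRm

/-! ### The deterministic conditions of a chain, tube sections, void probabilities -/

omit [FiniteDimensional ℝ E] [MeasurableSpace E] [BorelSpace E] in
/-- For fixed path coordinates the virtual tube is measurable (an open set union a closed ball).
[folklore] -/
theorem measurableSet_virtualTube [MeasurableSpace E] [OpensMeasurableSpace E] (ε : ℝ) (z : E × E)
    (t : ℝ) (p : List (ℝ × sphere (0 : E) 1)) : MeasurableSet (virtualTube ε z t p) := by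
  unfold virtualTube
  refine MeasurableSet.union (IsOpen.measurableSet ?_) isClosed_closedBall.measurableSet
  rw [show {a : E | ∃ τ ∈ Icc (0 : ℝ) t, dist a (Literature.Analysis.FunctionSpaces.virtualState z p τ).1 < ε} =
    ⋃ τ ∈ Icc (0 : ℝ) t, ball (Literature.Analysis.FunctionSpaces.virtualState z p τ).1 ε by ext a; simp [mem_ball]]
  exact isOpen_biUnion fun τ _ => isOpen_ball

/-- **The deterministic part of realizability is measurable in the chain**: for fixed
`ω₀, ε, z, t`, the set of `x : Fin n → E` such that `List.ofFn x` is a hit chain whose path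
coordinates have positive durations summing to `< t` and reproduce the chain. [folklore] -/
theorem measurableSet_chainDet [SecondCountableTopology E] (ω₀ : sphere (0 : E) 1) (ε : ℝ) (z : E × E)
    (t : ℝ) (n : ℕ) :
    MeasurableSet {x : Fin n → E | IsHitChain ε z (List.ofFn x) ∧
      (∀ q ∈ chainParams ω₀ ε z (List.ofFn x), 0 < q.1) ∧
      ((chainParams ω₀ ε z (List.ofFn x)).map Prod.fst).sum < t ∧
      Literature.Analysis.FunctionSpaces.virtualCentres ε z (chainParams ω₀ ε z (List.ofFn x)) = List.ofFn x} := by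
  obtain ⟨F, hF, hFeq⟩ := exists_measurable_chainParams (E := E) ω₀ ε n
  obtain ⟨G, hG, hGeq⟩ := exists_measurable_virtualCentres (E := E) ε n
  have hFz : Measurable fun x : Fin n → E => F (z, x) := hF.comp (measurable_const.prodMk measurable_id)
  have heq : {x : Fin n → E | IsHitChain ε z (List.ofFn x) ∧
      (∀ q ∈ chainParams ω₀ ε z (List.ofFn x), 0 < q.1) ∧
      ((chainParams ω₀ ε z (List.ofFn x)).map Prod.fst).sum < t ∧
      Literature.Analysis.FunctionSpaces.virtualCentres ε z (chainParams ω₀ ε z (List.ofFn x)) = List.ofFn x} =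
      {x | IsHitChain ε z (List.ofFn x)} ∩ (⋂ i, {x | 0 < (F (z, x) i).1}) ∩
        {x | ∑ i, (F (z, x) i).1 < t} ∩ ⋂ i, {x | G (z, F (z, x)) i = x i} := by
    ext x
    have hcp : chainParams ω₀ ε z (List.ofFn x) = List.ofFn (F (z, x)) := (hFeq (z, x)).symm
    simp only [mem_setOf_eq, mem_inter_iff, mem_iInter, hcp, List.forall_mem_ofFn_iff, List.map_ofFn,
      List.sum_ofFn]
    rw [← hGeq (z, F (z, x)), List.ofFn_inj, funext_iff]
    simp only [Function.comp_apply]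
    tauto
  rw [heq]
  refine ((MeasurableSet.inter ?_ (MeasurableSet.iInter fun i => ?_)).inter ?_).inter
    (MeasurableSet.iInter fun i => ?_)
  · exact (measurableSet_isHitChain (E := E) ε n).preimage (measurable_const.prodMk measurable_id)
  · exact measurableSet_lt measurable_const ((measurable_pi_apply i).comp hFz).fst
  · exact measurableSet_lt (Finset.measurable_sum _ fun i _ => ((measurable_pi_apply i).comp hFz).fst)
      measurable_const
  · exact measurableSet_eq_fun ((measurable_pi_apply i).comp (hG.comp (measurable_const.prodMk hFz)))
      (measurable_pi_apply i)

/-- **The guarded tube sections are measurable**: the set of `(x, a)` with `x` satisfying the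
deterministic chain conditions and `a` in the tube of its path coordinates (`t ≥ 0`). [folklore] -/
theorem measurableSet_chainDet_tube [SecondCountableTopology E] (ω₀ : sphere (0 : E) 1) (ε : ℝ)
    (z : E × E) {t : ℝ} (ht : 0 ≤ t) (n : ℕ) :
    MeasurableSet {p : (Fin n → E) × E | (IsHitChain ε z (List.ofFn p.1) ∧
      (∀ q ∈ chainParams ω₀ ε z (List.ofFn p.1), 0 < q.1) ∧
      ((chainParams ω₀ ε z (List.ofFn p.1)).map Prod.fst).sum < t ∧
      Literature.Analysis.FunctionSpaces.virtualCentres ε z (chainParams ω₀ ε z (List.ofFn p.1)) = List.ofFn p.1) ∧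
      p.2 ∈ virtualTube ε z t (chainParams ω₀ ε z (List.ofFn p.1))} := by
  obtain ⟨F, hF, hFeq⟩ := exists_measurable_chainParams (E := E) ω₀ ε n
  have hFz : Measurable fun x : Fin n → E => F (z, x) := hF.comp (measurable_const.prodMk measurable_id)
  have hdet := measurableSet_chainDet (E := E) ω₀ ε z t n
  have hgraph := measurableSet_virtualTube_graph (E := E) ε ht n
  -- as an intersection of the (cylinder over the) deterministic set and the pulled-back graph
  have heq : {p : (Fin n → E) × E | (IsHitChain ε z (List.ofFn p.1) ∧
      (∀ q ∈ chainParams ω₀ ε z (List.ofFn p.1), 0 < q.1) ∧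
      ((chainParams ω₀ ε z (List.ofFn p.1)).map Prod.fst).sum < t ∧
      Literature.Analysis.FunctionSpaces.virtualCentres ε z (chainParams ω₀ ε z (List.ofFn p.1)) = List.ofFn p.1) ∧
      p.2 ∈ virtualTube ε z t (chainParams ω₀ ε z (List.ofFn p.1))} =
      (Prod.fst ⁻¹' {x : Fin n → E | IsHitChain ε z (List.ofFn x) ∧
        (∀ q ∈ chainParams ω₀ ε z (List.ofFn x), 0 < q.1) ∧
        ((chainParams ω₀ ε z (List.ofFn x)).map Prod.fst).sum < t ∧
        Literature.Analysis.FunctionSpaces.virtualCentres ε z (chainParams ω₀ ε z (List.ofFn x)) = List.ofFn x}) ∩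
      ((fun p : (Fin n → E) × E => (((z, F (z, p.1)) : (E × E) × (Fin n → ℝ × sphere (0 : E) 1)), p.2)) ⁻¹'
        {q : ((E × E) × (Fin n → ℝ × sphere (0 : E) 1)) × E |
          (∀ i, 0 < (q.1.2 i).1) ∧ q.2 ∈ virtualTube ε q.1.1 t (List.ofFn q.1.2)}) := by
    ext p
    have hcp : chainParams ω₀ ε z (List.ofFn p.1) = List.ofFn (F (z, p.1)) := (hFeq (z, p.1)).symm
    simp only [mem_setOf_eq, mem_inter_iff, mem_preimage, hcp, List.forall_mem_ofFn_iff]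
    tauto
  rw [heq]
  exact (hdet.preimage measurable_fst).inter
    (hgraph.preimage ((measurable_const.prodMk (hFz.comp measurable_fst)).prodMk measurable_snd))

/-- **The guarded void probability is measurable in the chain**: for an s-finite law `P` of
configurations, `x ↦ 1{det}(x) · P{c : no point of c in the tube of x}` is measurable
(measurability of the measure of sections, `measurable_measure_prodMk_left`, applied to the
void event, which is measurable by the counting-kernel lemma). [folklore] -/
theorem measurable_chainVoidProb [SecondCountableTopology E] [SigmaCompactSpace E]
    (ω₀ : sphere (0 : E) 1) (ε : ℝ) (z : E × E) {t : ℝ} (ht : 0 ≤ t) (n : ℕ)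
    (P : Measure (Literature.Analysis.FunctionSpaces.PointConfig E)) [SFinite P] :
    Measurable fun x : Fin n → E => {x : Fin n → E | IsHitChain ε z (List.ofFn x) ∧
      (∀ q ∈ chainParams ω₀ ε z (List.ofFn x), 0 < q.1) ∧
      ((chainParams ω₀ ε z (List.ofFn x)).map Prod.fst).sum < t ∧
      Literature.Analysis.FunctionSpaces.virtualCentres ε z (chainParams ω₀ ε z (List.ofFn x)) = List.ofFn x}.indicator
      (fun x => P {c | c.count (virtualTube ε z t (chainParams ω₀ ε z (List.ofFn x))) = 0}) x := by
  classical
  have hdet := measurableSet_chainDet (E := E) ω₀ ε z t n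
  have hT := measurableSet_chainDet_tube (E := E) ω₀ ε z ht n
  -- the void event of the guarded sections, a measurable subset of `(Fin n → E) × PointConfig E`
  set V : Set ((Fin n → E) × Literature.Analysis.FunctionSpaces.PointConfig E) := {q | q.2.count (Prod.mk q ⁻¹'
    {r : ((Fin n → E) × Literature.Analysis.FunctionSpaces.PointConfig E) × E | (r.1.1, r.2) ∈
      {p : (Fin n → E) × E | (IsHitChain ε z (List.ofFn p.1) ∧
        (∀ q ∈ chainParams ω₀ ε z (List.ofFn p.1), 0 < q.1) ∧
        ((chainParams ω₀ ε z (List.ofFn p.1)).map Prod.fst).sum < t ∧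
        Literature.Analysis.FunctionSpaces.virtualCentres ε z (chainParams ω₀ ε z (List.ofFn p.1)) = List.ofFn p.1) ∧
        p.2 ∈ virtualTube ε z t (chainParams ω₀ ε z (List.ofFn p.1))}}) = 0} with hV
  have hVm : MeasurableSet V :=
    Literature.Analysis.FunctionSpaces.PointConfig.measurableSet_count_preimage_eq_zero
      (hT.preimage ((measurable_fst.comp measurable_fst).prodMk measurable_snd)) measurable_snd
  have hsec : Measurable fun x : Fin n → E => P (Prod.mk x ⁻¹' V) := measurable_measure_prodMk_left hVm
  have hite : Measurable fun x : Fin n → E => if x ∈ {x : Fin n → E | IsHitChain ε z (List.ofFn x) ∧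
      (∀ q ∈ chainParams ω₀ ε z (List.ofFn x), 0 < q.1) ∧
      ((chainParams ω₀ ε z (List.ofFn x)).map Prod.fst).sum < t ∧
      Literature.Analysis.FunctionSpaces.virtualCentres ε z (chainParams ω₀ ε z (List.ofFn x)) = List.ofFn x} then P (Prod.mk x ⁻¹' V)
      else (0 : ℝ≥0∞) := Measurable.ite hdet hsec measurable_const
  convert hite using 1
  funext x
  by_cases hx : x ∈ {x : Fin n → E | IsHitChain ε z (List.ofFn x) ∧
      (∀ q ∈ chainParams ω₀ ε z (List.ofFn x), 0 < q.1) ∧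
      ((chainParams ω₀ ε z (List.ofFn x)).map Prod.fst).sum < t ∧
      Literature.Analysis.FunctionSpaces.virtualCentres ε z (chainParams ω₀ ε z (List.ofFn x)) = List.ofFn x}
  · rw [indicator_of_mem hx, if_pos hx]
    congr 1
    ext c
    simp only [hV, mem_preimage, mem_setOf_eq]
    have hsect : (Prod.mk (x, c) ⁻¹' {r : ((Fin n → E) × Literature.Analysis.FunctionSpaces.PointConfig E) × E |
        (IsHitChain ε z (List.ofFn r.1.1) ∧
          (∀ q ∈ chainParams ω₀ ε z (List.ofFn r.1.1), 0 < q.1) ∧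
          ((chainParams ω₀ ε z (List.ofFn r.1.1)).map Prod.fst).sum < t ∧
          Literature.Analysis.FunctionSpaces.virtualCentres ε z (chainParams ω₀ ε z (List.ofFn r.1.1)) = List.ofFn r.1.1) ∧
          r.2 ∈ virtualTube ε z t (chainParams ω₀ ε z (List.ofFn r.1.1))}) =
        virtualTube ε z t (chainParams ω₀ ε z (List.ofFn x)) := by
      ext a
      simp only [mem_preimage, mem_setOf_eq]
      exact ⟨fun h => h.2, fun h => ⟨hx, h⟩⟩
    rw [hsect]
  · rw [indicator_of_notMem hx, if_neg hx]

end

end Literature.MathematicalPhysics.KineticTheory
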